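import Literature.GroupTheory.FiniteAbelian.StableTransversals
import Mathlib.GroupTheory.Perm.Cycle.Type
import HarnessLib

/-!
# Tian's transversal `φ = ⋃_{i<m} [t]^i φ₀` of `𝒜/[ϖ′]` for a non-square `[t]` of order `2m` (Prop. 4.6 proof):
# the finite-abelian-group facts behind the `p₀ ≡ 7 (mod 8)` case

Cell `bsd-monsky` (prover-A seat, g13; `run/shared/lean/pub/bsd-monsky/`). HONEST FRAMING (README §1): pure finite
abelian group theory — the objects of Tian 2014, Prop. 4.6's proof for `p₀ ≡ 7 (mod 8)`, stated for an abstract finite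
abelian group `G` with an involution `π` such that `G[2] = {1, π}` (for `G = Cl(ℚ(√−2p₀))` this is Gauss's genus theory,
`#𝒜[2] = 2^{t−1} = 2`, a tree theorem). Nothing asserted about curves; no named fact.

## Source (verbatim, arXiv:1210.8231, p0024 L16–L25)

"Note that `𝒜[2^∞]` is cyclic by Gauss' genus theory. Take an element `[t] ∈ 𝒜 − 2𝒜` (for example, a generator of
`𝒜[2^∞]`), then `𝒜/([t])` has odd cardinality. Let `φ₀` be a set of representatives for the `𝒜/([t])` and then we may
take `φ = ⋃_{i=0}^{m−1} [t]^i φ₀` if the order of `[t]` is `2m` (thus `[t]^m = [ϖ′]`). Use this `φ` to define `y_m`."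

## What is proved (kernel)

* a non-square exists (`exists_not_isSquare_of_mul_self_eq_one`), has even order (`even_orderOf_of_not_isSquare`),
  and `t^{m} = π` for `2m = ord(t)` when `G[2] = {1, π}` (`pow_half_orderOf_eq_of_not_isSquare`);
* `#(G/⟨t⟩)` is odd for such `t` (`odd_natCard_quotient_zpowers_of_not_isSquare`; the cyclicity of `G[2^∞]` is not
  needed: an element of order `2` of `G/⟨t⟩` would lift to `u` with `u² = t^j`, and both parities of `j` are absurd);
* **Tian's transversal** (`exists_special_transversal`): a transversal `φ` of `G/⟨π⟩` and a set `φ₀` of ODD cardinality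
  with `Σ_{a∈φ} f(a) = Σ_{i<m} Σ_{u∈φ₀} f(t^i u)` for every `f` — the form in which `y_{[t]φ} = y_φ + Σ_{φ₀}(z_{[ϖ′]u} − z_u)`
  is read off (`CMPointSystemDescentPrimeSeven.lean`);
* `G[2] = {1, π}` from `#G[2] = 2` (`eq_one_or_eq_of_mul_self_eq_one_of_natCard_eq_two`).

[cite: Tian2014, Prop. 4.6 proof (arXiv:1210.8231 p0024 L16–L25), §4.2 (p0022 L69–L70)] [cite: Cox2013, Prop. 3.11]
-/

noncomputable section

open scoped Classical

set_option autoImplicit false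

namespace Literature.NumberTheory.EllipticCurves.Tian2014

/-! ## §1 Non-squares, their orders, and `#(G/⟨t⟩)` odd -/

section CyclicTwoPart

variable {G : Type*} [CommGroup G] [Finite G]

/-- **A non-square exists** when some `π ≠ 1` squares to `1`: the squaring map is not injective, hence not
surjective on a finite group. [cite: Tian2014, Prop. 4.6 proof (p0024 L16: "Take an element [t] ∈ 𝒜 − 2𝒜")] -/
theorem exists_not_isSquare_of_mul_self_eq_one (π : G) (hπ2 : π * π = 1) (hπ1 : π ≠ 1) :
    ∃ t : G, ¬ IsSquare t := by
  by_contra h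
  have h' : ∀ t : G, IsSquare t := fun t => not_not.mp (fun ht => h ⟨t, ht⟩)
  have hsurj : Function.Surjective (fun g : G => g * g) := fun t => by
    obtain ⟨r, hr⟩ := h' t
    exact ⟨r, hr.symm⟩
  have hinj := (Finite.injective_iff_surjective).mpr hsurj
  exact hπ1 (hinj (show π * π = 1 * 1 by rw [hπ2, one_mul]))

omit [Finite G] in
/-- A non-square has even order. [cite: Tian2014, Prop. 4.6 proof (p0024 L18: "if the order of [t] is 2m")] -/
theorem even_orderOf_of_not_isSquare (t : G) (ht : ¬ IsSquare t) : Even (orderOf t) := by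
  by_contra hodd
  obtain ⟨k, hk⟩ := Nat.not_even_iff_odd.mp hodd
  apply ht
  refine ⟨t ^ (k + 1), ?_⟩
  rw [← sq, ← pow_mul]
  have : t ^ (2 * k + 2) = t := by
    rw [show 2 * k + 2 = (2 * k + 1) + 1 from by ring, pow_succ, ← hk, pow_orderOf_eq_one, one_mul]
  rw [show (k + 1) * 2 = 2 * k + 2 from by ring, this]

omit [Finite G] in
/-- A non-square is not `1`. [cite: Tian2014, Prop. 4.6 proof (p0024 L16: "[t] ∈ 𝒜 − 2𝒜")] -/
theorem ne_one_of_not_isSquare (t : G) (ht : ¬ IsSquare t) : t ≠ 1 := fun h => ht ⟨1, by rw [h, mul_one]⟩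

/-- **`t^{m} = π` for `2m = ord(t)`** when `G[2] = {1, π}` and `t` is not a square ("the order of `[t]` is `2m`
(thus `[t]^m = [ϖ′]`)"). [cite: Tian2014, Prop. 4.6 proof (p0024 L18–L19)] -/
theorem pow_half_orderOf_eq_of_not_isSquare (π : G) (h2 : ∀ u : G, u * u = 1 → u = 1 ∨ u = π) (t : G)
    (ht : ¬ IsSquare t) : t ^ (orderOf t / 2) = π := by
  obtain ⟨m, hm⟩ := even_orderOf_of_not_isSquare t ht
  have hm' : orderOf t / 2 = m := by omega
  rw [hm']
  have hpos : 0 < orderOf t := orderOf_pos_iff.mpr (isOfFinOrder_of_finite t)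
  have hm0 : 0 < m := by omega
  have hsq : t ^ m * t ^ m = 1 := by rw [← pow_add, ← hm, pow_orderOf_eq_one]
  rcases h2 _ hsq with h | h
  · exfalso
    have := orderOf_le_of_pow_eq_one hm0 h
    omega
  · exact h

/-- **`#(G/⟨t⟩)` is odd** for a non-square `t` when `G[2] = {1, π}` ("then `𝒜/([t])` has odd cardinality"):
an element of order `2` of `G/⟨t⟩` lifts to `u ∉ ⟨t⟩` with `u² = t^j`; `j` even gives `u·t^{−j/2} ∈ G[2] ⊆ ⟨t⟩`,
`j` odd gives `t = (u·t^{−(j−1)/2})²`. [cite: Tian2014, Prop. 4.6 proof (p0024 L16–L17)] -/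
theorem odd_natCard_quotient_zpowers_of_not_isSquare (π : G) (h2 : ∀ u : G, u * u = 1 → u = 1 ∨ u = π)
    (t : G) (ht : ¬ IsSquare t) : Odd (Nat.card (G ⧸ Subgroup.zpowers t)) := by
  by_contra heven
  rw [Nat.not_odd_iff_even] at heven
  haveI : Fact (Nat.Prime 2) := ⟨Nat.prime_two⟩
  obtain ⟨x, hx⟩ := exists_prime_orderOf_dvd_card' (G := G ⧸ Subgroup.zpowers t) 2 (even_iff_two_dvd.mp heven)
  obtain ⟨u, rfl⟩ := QuotientGroup.mk_surjective x
  have hπt : π ∈ Subgroup.zpowers t := by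
    rw [← pow_half_orderOf_eq_of_not_isSquare π h2 t ht]
    exact Subgroup.npow_mem_zpowers t _
  have hu1 : (u : G ⧸ Subgroup.zpowers t) ≠ 1 := by
    intro h; rw [h, orderOf_one] at hx; norm_num at hx
  have hu2 : ((u : G ⧸ Subgroup.zpowers t)) ^ 2 = 1 := by rw [← hx, pow_orderOf_eq_one]
  rw [← QuotientGroup.mk_pow, QuotientGroup.eq_one_iff] at hu2
  obtain ⟨k, hk⟩ := Subgroup.mem_zpowers_iff.mp hu2
  rcases Int.even_or_odd k with ⟨j, hj⟩ | ⟨j, hj⟩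
  · -- `u² = t^{2j}`: `(u t^{−j})² = 1`, so `u t^{−j} ∈ {1, π} ⊆ ⟨t⟩`, hence `u ∈ ⟨t⟩`
    have hsq : (u * t ^ (-j)) * (u * t ^ (-j)) = 1 := by
      rw [mul_mul_mul_comm, ← sq, ← hk, hj]
      group
    have hmem : u * t ^ (-j) ∈ Subgroup.zpowers t := by
      rcases h2 _ hsq with h | h
      · rw [h]; exact Subgroup.one_mem _
      · rw [h]; exact hπt
    apply hu1
    rw [QuotientGroup.eq_one_iff]
    have : u = (u * t ^ (-j)) * t ^ j := by rw [mul_assoc, ← zpow_add, neg_add_cancel, zpow_zero, mul_one]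
    rw [this]
    exact Subgroup.mul_mem _ hmem (Subgroup.zpow_mem_zpowers t j)
  · -- `u² = t^{2j+1}`: `t = (u t^{−j})²`
    apply ht
    refine ⟨u * t ^ (-j), ?_⟩
    rw [mul_mul_mul_comm, ← sq, ← hk, hj]
    group

end CyclicTwoPart

/-! ## §2 The special transversal `φ = ⋃_{i<m} t^i φ₀` of `G/⟨π⟩`, `π = t^m`, `φ₀` a transversal of `G/⟨t⟩` -/

section SpecialTransversal

variable {G : Type*} [CommGroup G] [Finite G]

/-- **Tian's transversal** (Prop. 4.6 proof: "Let `φ₀` be a set of representatives for `𝒜/([t])` and then we may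
take `φ = ⋃_{i=0}^{m−1} [t]^i φ₀` if the order of `[t]` is `2m` (thus `[t]^m = [ϖ′]`)"): for `G[2] = {1, π}` and a
non-square `t` of order `2m`, there are a transversal `φ` of `G/⟨π⟩` and a set `φ₀` of ODD cardinality such that
`Σ_{a∈φ} f(a) = Σ_{i<m} Σ_{u∈φ₀} f(t^i u)` for every `f` into an additive commutative group — the form in which
`y_{[t]φ} = y_φ + Σ_{φ₀}(z_{ϖ′u} − z_u)` is read off. [cite: Tian2014, Prop. 4.6 proof (p0024 L16–L25)] -/
theorem exists_special_transversal (π : G) (h2 : ∀ u : G, u * u = 1 → u = 1 ∨ u = π) (t : G) (ht : ¬ IsSquare t) :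
    ∃ (φ φ₀ : Finset G) (m : ℕ), orderOf t = 2 * m ∧ t ^ m = π ∧ Odd φ₀.card ∧
      (∀ a, Xor (a ∈ φ) (π * a ∈ φ)) ∧
      ∀ {M : Type} [AddCommGroup M] (f : G → M),
        ∑ a ∈ φ, f a = ∑ i ∈ Finset.range m, ∑ u ∈ φ₀, f (t ^ i * u) := by
  classical
  obtain ⟨m, hm⟩ := even_orderOf_of_not_isSquare t ht
  have hord : orderOf t = 2 * m := by omega
  have htm : t ^ m = π := by
    have := pow_half_orderOf_eq_of_not_isSquare π h2 t ht
    rwa [hord, Nat.mul_div_cancel_left m (by norm_num)] at this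
  have hpos : 0 < orderOf t := orderOf_pos_iff.mpr (isOfFinOrder_of_finite t)
  have hm0 : 0 < m := by omega
  -- the transversal `φ₀` of `G/⟨t⟩`
  set Q : Subgroup G := Subgroup.zpowers t with hQ
  obtain ⟨S, hS, -⟩ := Subgroup.exists_isComplement_left Q 1
  have hS' := Subgroup.isComplement_iff_existsUnique_inv_mul_mem.mp hS
  have hfin : S.Finite := Set.toFinite S
  set φ₀ : Finset G := hfin.toFinset with hφ₀
  have hφ₀mem : ∀ u, u ∈ φ₀ ↔ u ∈ S := fun u => Set.Finite.mem_toFinset hfin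
  -- `#φ₀ = #(G/⟨t⟩)` is odd
  have hcard : φ₀.card = Nat.card (G ⧸ Q) := by
    have h1 : Nat.card S * Nat.card Q = Nat.card G := hS.card_mul
    have h2' : Nat.card G = Nat.card (G ⧸ Q) * Nat.card Q := Subgroup.card_eq_card_quotient_mul_card_subgroup Q
    have hQpos : 0 < Nat.card Q := Nat.card_pos
    have h3 : Nat.card S = Nat.card (G ⧸ Q) := by
      apply Nat.eq_of_mul_eq_mul_right hQpos
      rw [h1, h2']
    haveI : Fintype S := hfin.fintype
    rw [← h3, hφ₀, Set.Finite.card_toFinset, Nat.card_eq_fintype_card]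
  have hodd : Odd φ₀.card := by
    rw [hcard]; exact odd_natCard_quotient_zpowers_of_not_isSquare π h2 t ht
  -- uniqueness of the representation `a = t^i u`
  have huniq : ∀ u ∈ φ₀, ∀ v ∈ φ₀, ∀ i j : ℕ, i < orderOf t → j < orderOf t → t ^ i * u = t ^ j * v →
      i = j ∧ u = v := by
    intro u hu v hv i j hi hj heq
    obtain ⟨⟨r, hrS⟩, -, hru⟩ := hS' v
    have key : ∀ w, w ∈ S → w⁻¹ * v ∈ Q → w = r := fun w hw hwv => congrArg Subtype.val (hru ⟨w, hw⟩ hwv)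
    have hvr : v = r := key v ((hφ₀mem v).mp hv) (by rw [inv_mul_cancel]; exact Q.one_mem)
    have hur : u = r := key u ((hφ₀mem u).mp hu) (by
      have : u⁻¹ * v = (t ^ j)⁻¹ * t ^ i := by
        apply mul_left_cancel (a := t ^ j * u)
        rw [mul_assoc, mul_inv_cancel_left, ← heq, mul_mul_mul_comm, mul_inv_cancel, one_mul, mul_comm]
      rw [this]
      exact Q.mul_mem (Q.inv_mem (Subgroup.npow_mem_zpowers t j)) (Subgroup.npow_mem_zpowers t i))
    have huv : u = v := hur.trans hvr.symm
    subst huv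
    refine ⟨?_, rfl⟩
    have : t ^ i = t ^ j := mul_right_cancel heq
    exact pow_injOn_Iio_orderOf (Set.mem_Iio.mpr hi) (Set.mem_Iio.mpr hj) this
  -- the transversal `φ`
  set e : ℕ × G → G := fun p => t ^ p.1 * p.2 with he
  set φ : Finset G := (Finset.range m ×ˢ φ₀).image e with hφ
  have hinj : Set.InjOn e ↑(Finset.range m ×ˢ φ₀) := by
    intro p hp q hq hpq
    rw [Finset.coe_product, Set.mem_prod, Finset.mem_coe, Finset.mem_coe, Finset.mem_range] at hp hq
    obtain ⟨h1, h2⟩ := huniq p.2 hp.2 q.2 hq.2 p.1 q.1 (by omega) (by omega) hpq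
    exact Prod.ext h1 h2
  refine ⟨φ, φ₀, m, hord, htm, hodd, ?_, ?_⟩
  · -- `Xor (a ∈ φ) (π a ∈ φ)`
    intro a
    obtain ⟨⟨u, huS⟩, hua, -⟩ := hS' a
    simp only at hua
    have huφ₀ : u ∈ φ₀ := (hφ₀mem u).mpr huS
    obtain ⟨k, hk⟩ := Subgroup.mem_zpowers_iff.mp hua
    -- `a = t^j u` with `j < 2m`
    set j : ℕ := (k % (orderOf t : ℤ)).toNat with hj
    have hkmod : 0 ≤ k % (orderOf t : ℤ) := Int.emod_nonneg _ (by exact_mod_cast hpos.ne')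
    have hjlt : j < orderOf t := by
      have := Int.emod_lt_of_pos k (by exact_mod_cast hpos : (0 : ℤ) < orderOf t)
      omega
    have haj : a = t ^ j * u := by
      have : t ^ j = t ^ k := by
        rw [← zpow_natCast, hj, Int.toNat_of_nonneg hkmod, zpow_mod_orderOf]
      rw [this, hk, mul_comm, mul_inv_cancel_left]
    have hmem_iff : ∀ b, b ∈ φ ↔ ∃ i, i < m ∧ ∃ v ∈ φ₀, t ^ i * v = b := by
      intro b
      rw [hφ, Finset.mem_image]
      constructor
      · rintro ⟨⟨i, v⟩, hp, rfl⟩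
        rw [Finset.mem_product, Finset.mem_range] at hp
        exact ⟨i, hp.1, v, hp.2, rfl⟩
      · rintro ⟨i, hi, v, hv, rfl⟩
        exact ⟨(i, v), Finset.mem_product.mpr ⟨Finset.mem_range.mpr hi, hv⟩, rfl⟩
    have hin : a ∈ φ ↔ j < m := by
      rw [hmem_iff]
      constructor
      · rintro ⟨i, hi, v, hv, hiv⟩
        rw [haj] at hiv
        obtain ⟨rfl, -⟩ := huniq v hv u huφ₀ i j (by omega) hjlt hiv
        exact hi
      · intro hjm
        exact ⟨j, hjm, u, huφ₀, haj.symm⟩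
    have hπin : π * a ∈ φ ↔ ¬ j < m := by
      rw [hmem_iff]
      constructor
      · rintro ⟨i, hi, v, hv, hiv⟩ hjm
        rw [haj, ← htm, ← mul_assoc, ← pow_add] at hiv
        obtain ⟨rfl, -⟩ := huniq v hv u huφ₀ i (m + j) (by omega) (by omega) hiv
        omega
      · intro hjm
        refine ⟨j - m, by omega, u, huφ₀, ?_⟩
        rw [haj, ← htm, ← mul_assoc, ← pow_add]
        have : t ^ (j - m) = t ^ (m + j) := by
          rw [← pow_mod_orderOf t (m + j), hord, show m + j = (j - m) + 2 * m from by omega,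
            Nat.add_mod_right, Nat.mod_eq_of_lt (by omega)]
        rw [this]
    rw [hin, hπin]
    by_cases hjm : j < m
    · exact Or.inl ⟨hjm, not_not.mpr hjm⟩
    · exact Or.inr ⟨hjm, hjm⟩
  · -- the sum over `φ`
    intro M _ f
    rw [hφ, Finset.sum_image hinj, Finset.sum_product]

end SpecialTransversal

/-! ## §3 `G[2] = {1, π}` from `#G[2] = 2` -/

/-- **A group with exactly two elements of order dividing `2` has `G[2] = {1, π}`** for any `π ≠ 1` with `π² = 1`.
[cite: Tian2014, §4.2 (p0022 L69–L70: "the class of ϖ′ … is the only non-trivial element in 𝒜[2] ∩ 2𝒜")] [cite: Cox2013, Prop. 3.11] -/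
theorem eq_one_or_eq_of_mul_self_eq_one_of_natCard_eq_two {G : Type*} [CommGroup G] (π : G) (hπ2 : π * π = 1)
    (hπ1 : π ≠ 1) (hcard : Nat.card {c : G // c ^ 2 = 1} = 2) : ∀ u : G, u * u = 1 → u = 1 ∨ u = π := by
  classical
  intro u hu
  by_contra hne
  have hu1 : u ≠ 1 := fun h => hne (Or.inl h)
  have huπ : u ≠ π := fun h => hne (Or.inr h)
  haveI : Finite {c : G // c ^ 2 = 1} := Nat.finite_of_card_ne_zero (by rw [hcard]; norm_num)
  haveI : Fintype {c : G // c ^ 2 = 1} := Fintype.ofFinite _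
  set x₁ : {c : G // c ^ 2 = 1} := ⟨1, by rw [one_pow]⟩
  set x₂ : {c : G // c ^ 2 = 1} := ⟨π, by rw [sq, hπ2]⟩
  set x₃ : {c : G // c ^ 2 = 1} := ⟨u, by rw [sq, hu]⟩
  have h3 : ({x₁, x₂, x₃} : Finset {c : G // c ^ 2 = 1}).card = 3 :=
    Finset.card_eq_three.mpr ⟨x₁, x₂, x₃, fun h => hπ1 (congrArg Subtype.val h).symm,
      fun h => hu1 (congrArg Subtype.val h).symm, fun h => huπ (congrArg Subtype.val h).symm, rfl⟩
  have := Finset.card_le_univ ({x₁, x₂, x₃} : Finset {c : G // c ^ 2 = 1})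
  rw [h3, ← Nat.card_eq_fintype_card, hcard] at this
  omega

end Literature.NumberTheory.EllipticCurves.Tian2014

end
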